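import Summits.KontsevichZagierPeriods.KontsevichZagierPeriods.Theorems.UnfoldedStokesStokesGenerationFibrewiseRungScalingSwaps
import Mathlib.Analysis.Calculus.Deriv.Inv
import Mathlib.Analysis.Calculus.Deriv.Mul

/-!
# `StokesGeneration` (stmt-KontsevichZagierPeriods-3586) — line `fibrewise_stokes`, stub `stub_hillRelationB`

Registered rung stub HB (rung 19, the FIVE-TERM RELATION of the dilogarithm in Hill's form, wave 3) of the
line `fibrewise_stokes` of the crux `StokesGeneration` (route UnfoldedStokes): **the parametric three-term
dlog certificate B, reduced by `b v`.** On the closed cube `[0,1]³` (`s = x 0` the loop variable, `y = x 1`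
the homotopy variable, `v = x 2` a silent parameter), for real algebraic `a`, `b` with `|a| < 1`, `|b| < 1`
and a continuous `ℚ`-semialgebraic coefficient `γ(v)`, the function
`γ(v) · [(1 − a)/(1 − bv + bv(1 − a)s) − 1/(1 − bvs) + a/(1 − abvs)]`
is fibrewise-Stokes decomposable (`FibStokesDecomposable 3`, `Theorems/UnfoldedStokesDefs.lean`).

Proof. Write `w = bv` and consider the loop `P(s) = (1 + s·w(1−a)/(1−w))(1 − ws)/(1 − aws)` (`P(0) = P(1) = 1`,
`P > 0`). Its logarithmic `s`-derivative is `w` times the displayed bracket, and both `P − 1` and `P_s` carry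
the factor `w` algebraically: `P − 1 = w Q` with `Q = w(1−a)s(1−s)/((1−w)(1−aws))` and `P_s = w R` with
`R = Q_s = w(1−a)(1 − 2s + aws²)/((1−w)(1−aws)²)`, both regular on the whole cube. With the homotopy
`E = 1 + wQy = (1 − y) + yP > 0`, the two fibrewise Stokes elements
* along `s` (direction `0`) with primitive `G₀ = γ(v) Q/E` and fibre derivative `D₀ = γ(v) R/E²`,
* along `y` (direction `1`) with primitive `G₁ = γ(v) y R (1/P − 1/E)` and fibre derivative
  `D₁ = γ(v) R (1/P − 1/E²)`,
have ALL four faces vanishing (`Q = 0` at `s ∈ {0,1}`; `y = 0`; `E = P` at `y = 1`), and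
`D₀ + D₁ = γ(v) R/P = γ(v) · [bracket]` is a rational identity valid on the whole cube (including `v = 0`,
`b = 0`). The two integrands `Dⱼ` are carried by closed-cube representations (`exists_cubeRep`), the family is
decomposable (`fibStokesDecomposable_of_elements`), and `fibStokesDecomposable_congr_off_null` with the empty
null set concludes. All denominators are positive on the closed cube since `|w| ≤ |b| < 1`, `|a| < 1`.

References: D. Zagier, *The dilogarithm function* (2007), §I.2 (the five-term relation);
M. Kontsevich, D. Zagier, *Periods* (2001), §1.2 (rule (3), Newton–Leibniz/Stokes);
J. Ayoub, *Une version relative de la conjecture des périodes de Kontsevich–Zagier* (2015), Rem. 1.5.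
-/

noncomputable section

-- `Summit.KontsevichZagierPeriods.KontsevichZagierPeriods.…` is the tree's mandated layout (single-conjunct summit).
set_option linter.dupNamespace false

namespace Summit.KontsevichZagierPeriods.KontsevichZagierPeriods.Cruxes.StokesGeneration.FibrewiseStokes

open MeasureTheory Set
open Literature.NumberTheory.Transcendental
open Literature.NumberTheory.Transcendental.KZ
open Literature.ModelTheory.ExponentialFields (IsSemialgebraic)

/-! ## Positivity of the denominators on the closed cube -/

/-- For `|c| < 1` and `p ∈ [0,1]`, `1 − c p > 0`. [folklore] -/
private theorem hillB_den_pos {c p : ℝ} (hc : |c| < 1) (hp : p ∈ Set.Icc (0:ℝ) 1) : 0 < 1 - c * p := by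
  obtain ⟨-, hc2⟩ := abs_lt.mp hc
  rcases le_or_gt 0 c with h0 | h0
  · nlinarith [mul_nonneg h0 (sub_nonneg.2 hp.2)]
  · nlinarith [mul_nonneg (neg_nonneg.2 h0.le) hp.1]

/-- For `|c| < 1` and `p ∈ [0,1]`, `|c p| < 1`. [folklore] -/
private theorem hillB_abs_mul_lt {c p : ℝ} (hc : |c| < 1) (hp : p ∈ Set.Icc (0:ℝ) 1) : |c * p| < 1 := by
  rw [abs_mul, abs_of_nonneg hp.1]
  exact (mul_le_of_le_one_right (abs_nonneg c) hp.2).trans_lt hc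

/-- For `|a| < 1`, `|w| < 1` and `s ∈ [0,1]`, the first Hill denominator `1 − w + w(1 − a)s` is positive:
if `w ≥ 0` it is `≥ 1 − w`, otherwise it is `≥ 1 − aw`. [folklore] -/
private theorem hillB_u_pos {a w s : ℝ} (ha : |a| < 1) (hw : |w| < 1) (hs : s ∈ Set.Icc (0:ℝ) 1) :
    0 < 1 - w + w * (1 - a) * s := by
  obtain ⟨ha1, ha2⟩ := abs_lt.mp ha
  obtain ⟨hw1, hw2⟩ := abs_lt.mp hw
  rcases le_or_gt 0 w with h0 | h0
  · nlinarith [mul_nonneg (mul_nonneg h0 (sub_nonneg.2 ha2.le)) hs.1]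
  · nlinarith [mul_nonneg (mul_nonneg (neg_nonneg.2 h0.le) (sub_nonneg.2 ha2.le)) (sub_nonneg.2 hs.2),
      mul_pos (sub_pos.2 ha2) (by linarith : (0:ℝ) < 1 + w),
      mul_pos (by linarith : (0:ℝ) < 1 + a) (sub_pos.2 hw2)]

/-! ## Calculus of the two primitives along their fibres -/

/-- `d/du [k u (1 − u)/(m (1 − d u))] = k (1 − 2u + d u²)/(m (1 − d u)²)` wherever `m ≠ 0` and
`1 − d u ≠ 0` (quotient rule). [folklore] -/
private theorem hillB_hasDerivAt_Q {k m d s : ℝ} (hm : m ≠ 0) (hd : 1 - d * s ≠ 0) :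
    HasDerivAt (fun u => k * u * (1 - u) / (m * (1 - d * u)))
      (k * (1 - 2 * s + d * s ^ 2) / (m * (1 - d * s) ^ 2)) s := by
  have hnum : HasDerivAt (fun u => k * u * (1 - u)) (k * 1 * (1 - s) + k * s * (-1)) s :=
    ((hasDerivAt_id' s).const_mul k).mul ((hasDerivAt_id' s).const_sub 1)
  have hden : HasDerivAt (fun u => m * (1 - d * u)) (m * (-(d * 1))) s :=
    (((hasDerivAt_id' s).const_mul d).const_sub 1).const_mul m
  refine (hnum.div hden (mul_ne_zero hm hd)).congr_deriv ?_
  field_simp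
  ring

/-- Direction `0`: `d/du [g Q(u)/(1 + w Q(u) y)] = g Q'(u)/(1 + w Q(u) y)²` (quotient rule; the `y`-terms
cancel in the numerator). [folklore] -/
private theorem hillB_hasDerivAt_dir0 {g w y s q' : ℝ} {Q : ℝ → ℝ} (hQ : HasDerivAt Q q' s)
    (hE : 1 + w * Q s * y ≠ 0) :
    HasDerivAt (fun u => g * Q u / (1 + w * Q u * y)) (g * q' / (1 + w * Q s * y) ^ 2) s := by
  have hden : HasDerivAt (fun u => 1 + w * Q u * y) (w * q' * y) s :=
    ((hQ.const_mul w).mul_const y).const_add 1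
  refine ((hQ.const_mul g).div hden hE).congr_deriv ?_
  congr 1
  ring

/-- Direction `1`: `d/du [g u r (1/p − 1/(1 + c u))] = g r (1/p − 1/(1 + c u)²)` wherever `1 + c u ≠ 0`
(product and quotient rules). [folklore] -/
private theorem hillB_hasDerivAt_dir1 {g r p c s : ℝ} (hE : 1 + c * s ≠ 0) :
    HasDerivAt (fun u => g * u * r * (1 / p - 1 / (1 + c * u)))
      (g * r * (1 / p - 1 / (1 + c * s) ^ 2)) s := by
  have h1 : HasDerivAt (fun u => 1 + c * u) (c * 1) s :=
    ((hasDerivAt_id' s).const_mul c).const_add 1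
  have h2 : HasDerivAt (fun u => g * u * r) (g * 1 * r) s :=
    ((hasDerivAt_id' s).const_mul g).mul_const r
  refine (h2.fun_mul ((hasDerivAt_const s (1 / p)).fun_sub
    ((hasDerivAt_const s (1:ℝ)).fun_div h1 hE))).congr_deriv ?_
  generalize hF : 1 + c * s = F at hE ⊢
  linear_combination (g * r * F⁻¹) * mul_inv_cancel₀ hE + (g * r * F⁻¹ ^ 2) * hF

/-! ## The certificate -/

/-- **Registered stub `stub_hillRelationB` (rung 19, HB): the parametric three-term dlog certificate B reduced
by `bv`.** On `[0,1]³` (`s = x 0`, `y = x 1`, `v = x 2`), for real algebraic `|a| < 1`, `|b| < 1` and a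
continuous `ℚ`-semialgebraic coefficient `γ`, the function
`γ(v) · [(1 − a)/(1 − bv + bv(1 − a)s) − 1/(1 − bvs) + a/(1 − abvs)]` is fibrewise-Stokes decomposable: it is
`D₀ + D₁` for the two elements with primitives `G₀ = γ(v) Q/E` (along `s`) and `G₁ = γ(v) y R (1/P − 1/E)`
(along `y`), where `Q = bv(1−a)s(1−s)/((1−bv)(1−abvs))`, `R = ∂_s Q`, `P = 1 + bvQ`, `E = 1 + bvQy`; all four
faces vanish. [cite: Zagier2007Dilogarithm, §I.2] -/
theorem stub_hillRelationB (a b : ℝ) (ha : IsAlgebraic ℚ a) (hb : IsAlgebraic ℚ b) (ha1 : |a| < 1) (hb1 : |b| < 1)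
    (γ : ℝ → ℝ) (hγ : IsSemialgebraicFunOn ℚ (Set.pi Set.univ (fun _ : Fin 1 => Set.Icc (0:ℝ) 1)) (fun z => γ (z 0)))
    (hγc : ContinuousOn γ (Set.Icc (0:ℝ) 1)) :
    FibStokesDecomposable 3 (fun x => γ (x 2) * ((1 - a) / (1 - b * x 2 + b * x 2 * (1 - a) * x 0) -
      1 / (1 - b * x 2 * x 0) + a / (1 - a * b * x 2 * x 0))) := by
  classical
  set C : Set (Fin 3 → ℝ) := Set.pi Set.univ (fun _ : Fin 3 => Set.Icc (0:ℝ) 1) with hC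
  have hCsa : IsSemialgebraic ℚ C := by rw [hC, ← cube_eq_pi]; exact isSemialgebraic_cube
  have hCc : IsCompact C := isCompact_univ_pi fun _ => isCompact_Icc
  have hmem : ∀ x ∈ C, ∀ i, x i ∈ Set.Icc (0:ℝ) 1 := fun x hx i => (Set.mem_univ_pi.mp hx) i
  have hupd : ∀ x ∈ C, ∀ (i : Fin 3), ∀ s ∈ Set.Icc (0:ℝ) 1, Function.update x i s ∈ C :=
    fun x hx i s hs => update_mem_cubePi hx i hs
  have h10 : (1 : Fin 3) ≠ 0 := by decide
  have h20 : (2 : Fin 3) ≠ 0 := by decide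
  have h01 : (0 : Fin 3) ≠ 1 := by decide
  have h21 : (2 : Fin 3) ≠ 1 := by decide
  -- `w = b v` and `a w` have absolute value `< 1` on the cube; the four denominators are positive
  have hw : ∀ x ∈ C, |b * x 2| < 1 := fun x hx => hillB_abs_mul_lt hb1 (hmem x hx 2)
  have haw : ∀ x ∈ C, |a * b * x 2| < 1 := fun x hx => by
    rw [mul_assoc, abs_mul]
    exact (mul_le_of_le_one_left (abs_nonneg _) ha1.le).trans_lt (hw x hx)
  have hden1 : ∀ x ∈ C, 0 < 1 - b * x 2 := fun x hx => hillB_den_pos hb1 (hmem x hx 2)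
  have hden2 : ∀ x ∈ C, 0 < 1 - b * x 2 * x 0 := fun x hx => hillB_den_pos (hw x hx) (hmem x hx 0)
  have hden3 : ∀ x ∈ C, 0 < 1 - a * b * x 2 * x 0 := fun x hx => hillB_den_pos (haw x hx) (hmem x hx 0)
  have hden4 : ∀ x ∈ C, 0 < 1 - b * x 2 + b * x 2 * (1 - a) * x 0 := fun x hx =>
    hillB_u_pos ha1 (hw x hx) (hmem x hx 0)
  have hQden : ∀ x ∈ C, (1 - b * x 2) * (1 - a * b * x 2 * x 0) ≠ 0 := fun x hx =>
    mul_ne_zero (hden1 x hx).ne' (hden3 x hx).ne'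
  have hRden : ∀ x ∈ C, (1 - b * x 2) * (1 - a * b * x 2 * x 0) ^ 2 ≠ 0 := fun x hx =>
    mul_ne_zero (hden1 x hx).ne' (pow_ne_zero 2 (hden3 x hx).ne')
  -- semialgebraic and continuous atoms on `C`
  have hx0 : IsSemialgebraicFunOn ℚ C (fun x => x 0) := isSemialgebraicFunOn_apply hCsa 0
  have hx1 : IsSemialgebraicFunOn ℚ C (fun x => x 1) := isSemialgebraicFunOn_apply hCsa 1
  have hx2 : IsSemialgebraicFunOn ℚ C (fun x => x 2) := isSemialgebraicFunOn_apply hCsa 2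
  have hca : IsSemialgebraicFunOn ℚ C (fun _ => a) := isSemialgebraicFunOn_const_of_isAlgebraic hCsa ha
  have hcb : IsSemialgebraicFunOn ℚ C (fun _ => b) := isSemialgebraicFunOn_const_of_isAlgebraic hCsa hb
  have hc1 : IsSemialgebraicFunOn ℚ C (fun _ => (1:ℝ)) :=
    isSemialgebraicFunOn_const_of_isAlgebraic hCsa isAlgebraic_one
  have hc2 : IsSemialgebraicFunOn ℚ C (fun _ => (2:ℝ)) := isSemialgebraicFunOn_const_ofNat hCsa 2
  have hγC : IsSemialgebraicFunOn ℚ C (fun x => γ (x 2)) := isSemialgebraicFunOn_read hγ 2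
  have hγCc : ContinuousOn (fun x : Fin 3 → ℝ => γ (x 2)) C :=
    hγc.comp (continuous_apply 2).continuousOn fun x hx => hmem x hx 2
  have hwc : Continuous fun x : Fin 3 → ℝ => b * x 2 := by fun_prop
  -- the reduced primitives `Q = (P − 1)/(bv)`, `R = P_s/(bv) = ∂_s Q`, the loop `P`, the homotopy `E`
  obtain ⟨Q, hQ⟩ : ∃ Q : (Fin 3 → ℝ) → ℝ, Q = fun x =>
      b * x 2 * (1 - a) * x 0 * (1 - x 0) / ((1 - b * x 2) * (1 - a * b * x 2 * x 0)) := ⟨_, rfl⟩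
  obtain ⟨R, hR⟩ : ∃ R : (Fin 3 → ℝ) → ℝ, R = fun x =>
      b * x 2 * (1 - a) * (1 - 2 * x 0 + a * b * x 2 * x 0 ^ 2) /
        ((1 - b * x 2) * (1 - a * b * x 2 * x 0) ^ 2) := ⟨_, rfl⟩
  obtain ⟨P, hP⟩ : ∃ P : (Fin 3 → ℝ) → ℝ, P = fun x => 1 + b * x 2 * Q x := ⟨_, rfl⟩
  obtain ⟨E, hE⟩ : ∃ E : (Fin 3 → ℝ) → ℝ, E = fun x => 1 + b * x 2 * Q x * x 1 := ⟨_, rfl⟩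
  have hQsa : IsSemialgebraicFunOn ℚ C Q := by
    rw [hQ]
    exact ((((hcb.fun_mul hx2).fun_mul (hc1.fun_sub hca)).fun_mul hx0).fun_mul (hc1.fun_sub hx0)).div
      ((hc1.fun_sub (hcb.fun_mul hx2)).fun_mul (hc1.fun_sub (((hca.fun_mul hcb).fun_mul hx2).fun_mul hx0)))
      hQden
  have hRsa : IsSemialgebraicFunOn ℚ C R := by
    rw [hR]
    exact (((hcb.fun_mul hx2).fun_mul (hc1.fun_sub hca)).fun_mul
      ((hc1.fun_sub (hc2.fun_mul hx0)).fun_add (((hca.fun_mul hcb).fun_mul hx2).fun_mul (hx0.fun_pow 2)))).div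
      ((hc1.fun_sub (hcb.fun_mul hx2)).fun_mul
        ((hc1.fun_sub (((hca.fun_mul hcb).fun_mul hx2).fun_mul hx0)).fun_pow 2)) hRden
  have hPsa : IsSemialgebraicFunOn ℚ C P := by
    rw [hP]; exact hc1.fun_add ((hcb.fun_mul hx2).fun_mul hQsa)
  have hEsa : IsSemialgebraicFunOn ℚ C E := by
    rw [hE]; exact hc1.fun_add (((hcb.fun_mul hx2).fun_mul hQsa).fun_mul hx1)
  have hQc : ContinuousOn Q C := by
    rw [hQ]
    exact (by fun_prop : Continuous fun x : Fin 3 → ℝ =>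
        b * x 2 * (1 - a) * x 0 * (1 - x 0)).continuousOn.div
      (by fun_prop : Continuous fun x : Fin 3 → ℝ =>
        (1 - b * x 2) * (1 - a * b * x 2 * x 0)).continuousOn hQden
  have hRc : ContinuousOn R C := by
    rw [hR]
    exact (by fun_prop : Continuous fun x : Fin 3 → ℝ =>
        b * x 2 * (1 - a) * (1 - 2 * x 0 + a * b * x 2 * x 0 ^ 2)).continuousOn.div
      (by fun_prop : Continuous fun x : Fin 3 → ℝ =>
        (1 - b * x 2) * (1 - a * b * x 2 * x 0) ^ 2).continuousOn hRden
  have hPc : ContinuousOn P C := by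
    rw [hP]; exact continuousOn_const.add (hwc.continuousOn.mul hQc)
  have hEc : ContinuousOn E C := by
    rw [hE]; exact continuousOn_const.add ((hwc.continuousOn.mul hQc).mul (continuous_apply 1).continuousOn)
  -- `P` in product form, positivity of `P` and of `E = (1 − y) + y P`
  have hPalt : ∀ x ∈ C, P x = (1 - b * x 2 + b * x 2 * (1 - a) * x 0) * (1 - b * x 2 * x 0) /
      ((1 - b * x 2) * (1 - a * b * x 2 * x 0)) := by
    intro x hx
    have h1 := (hden1 x hx).ne'
    have h3 := (hden3 x hx).ne'
    -- `field_simp` normalises the monomial `a b v s` in the atom order `b, v, a, s`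
    have h3' : 1 - b * x 2 * a * x 0 ≠ 0 := by convert h3 using 2; ring
    simp only [hP, hQ]
    field_simp
    ring
  have hPpos : ∀ x ∈ C, 0 < P x := fun x hx => by
    rw [hPalt x hx]
    exact div_pos (mul_pos (hden4 x hx) (hden2 x hx)) (mul_pos (hden1 x hx) (hden3 x hx))
  have hPne : ∀ x ∈ C, P x ≠ 0 := fun x hx => (hPpos x hx).ne'
  have hEalt : ∀ x, E x = 1 + (P x - 1) * x 1 := fun x => by simp only [hE, hP]; ring
  have hEpos : ∀ x ∈ C, 0 < E x := by
    intro x hx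
    obtain ⟨h1l, h1u⟩ := hmem x hx 1
    have hp := hPpos x hx
    rw [hEalt]
    rcases le_total 1 (P x) with h | h
    · nlinarith [mul_nonneg (sub_nonneg.2 h) h1l]
    · nlinarith [mul_nonneg (sub_nonneg.2 h) (sub_nonneg.2 h1u)]
  have hEne : ∀ x ∈ C, E x ≠ 0 := fun x hx => (hEpos x hx).ne'
  have hE2ne : ∀ x ∈ C, E x ^ 2 ≠ 0 := fun x hx => pow_ne_zero 2 (hEne x hx)
  -- the witnesses
  obtain ⟨G0, hG0⟩ : ∃ G0 : (Fin 3 → ℝ) → ℝ, G0 = fun x => γ (x 2) * Q x / E x := ⟨_, rfl⟩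
  obtain ⟨D0, hD0⟩ : ∃ D0 : (Fin 3 → ℝ) → ℝ, D0 = fun x => γ (x 2) * R x / E x ^ 2 := ⟨_, rfl⟩
  obtain ⟨G1, hG1⟩ : ∃ G1 : (Fin 3 → ℝ) → ℝ,
      G1 = fun x => γ (x 2) * x 1 * R x * (1 / P x - 1 / E x) := ⟨_, rfl⟩
  obtain ⟨D1, hD1⟩ : ∃ D1 : (Fin 3 → ℝ) → ℝ,
      D1 = fun x => γ (x 2) * R x * (1 / P x - 1 / E x ^ 2) := ⟨_, rfl⟩
  have hG0sa : IsSemialgebraicFunOn ℚ C G0 := by rw [hG0]; exact (hγC.fun_mul hQsa).div hEsa hEne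
  have hD0sa : IsSemialgebraicFunOn ℚ C D0 := by
    rw [hD0]; exact (hγC.fun_mul hRsa).div (hEsa.fun_pow 2) hE2ne
  have hG1sa : IsSemialgebraicFunOn ℚ C G1 := by
    rw [hG1]
    exact ((hγC.fun_mul hx1).fun_mul hRsa).fun_mul ((hc1.div hPsa hPne).fun_sub (hc1.div hEsa hEne))
  have hD1sa : IsSemialgebraicFunOn ℚ C D1 := by
    rw [hD1]
    exact (hγC.fun_mul hRsa).fun_mul ((hc1.div hPsa hPne).fun_sub (hc1.div (hEsa.fun_pow 2) hE2ne))
  have hG0c : ContinuousOn G0 C := by rw [hG0]; exact (hγCc.mul hQc).div hEc hEne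
  have hD0c : ContinuousOn D0 C := by rw [hD0]; exact (hγCc.mul hRc).div (hEc.pow 2) hE2ne
  have hG1c : ContinuousOn G1 C := by
    rw [hG1]
    exact ((hγCc.mul (continuous_apply 1).continuousOn).mul hRc).mul
      ((continuousOn_const.div hPc hPne).sub (continuousOn_const.div hEc hEne))
  have hD1c : ContinuousOn D1 C := by
    rw [hD1]
    exact (hγCc.mul hRc).mul ((continuousOn_const.div hPc hPne).sub (continuousOn_const.div (hEc.pow 2) hE2ne))
  -- all four faces vanish identically
  have hQface : ∀ (x : Fin 3 → ℝ) (t : ℝ), t = 0 ∨ t = 1 → Q (Function.update x 0 t) = 0 := by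
    rintro x t (rfl | rfl) <;> simp [hQ]
  have hG0face : ∀ (x : Fin 3 → ℝ) (t : ℝ), t = 0 ∨ t = 1 → G0 (Function.update x 0 t) = 0 :=
    fun x t ht => by rw [hG0]; simp only [hQface x t ht, mul_zero, zero_div]
  have hG1zero : ∀ x : Fin 3 → ℝ, G1 (Function.update x 1 0) = 0 := fun x => by
    rw [hG1]; simp only [Function.update_self, mul_zero, zero_mul]
  have hG1one : ∀ x : Fin 3 → ℝ, G1 (Function.update x 1 1) = 0 := fun x => by
    rw [hG1, hE, hP]; simp only [Function.update_self, mul_one, sub_self, mul_zero]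
  -- bounds and fibre maps
  have hbound : ∀ {F : (Fin 3 → ℝ) → ℝ}, ContinuousOn F C → ∃ B : ℝ, ∀ x ∈ C, |F x| ≤ B := fun hF => by
    obtain ⟨B, hB⟩ := hCc.exists_bound_of_continuousOn hF
    exact ⟨B, fun x hx => by simpa [Real.norm_eq_abs] using hB x hx⟩
  have hcu : ∀ (x : Fin 3 → ℝ) (i : Fin 3), Continuous fun s : ℝ => Function.update x i s :=
    fun x i => continuous_const.update i continuous_id
  -- derivatives along the open fibres
  have hder0 : ∀ x ∈ C, x 0 ∈ Set.Ioo (0:ℝ) 1 →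
      HasDerivAt (fun s : ℝ => G0 (Function.update x 0 s)) (D0 x) (x 0) := by
    intro x hx _
    have hQfib : HasDerivAt (fun u : ℝ => Q (Function.update x 0 u)) (R x) (x 0) := by
      have hfun : (fun u : ℝ => Q (Function.update x 0 u)) = fun u =>
          b * x 2 * (1 - a) * u * (1 - u) / ((1 - b * x 2) * (1 - a * b * x 2 * u)) := by
        funext u; rw [hQ]; simp only [Function.update_self, Function.update_of_ne h20]
      rw [hfun, hR]
      beta_reduce
      exact hillB_hasDerivAt_Q (hden1 x hx).ne' (hden3 x hx).ne'
    have hfun : (fun u : ℝ => G0 (Function.update x 0 u)) = fun u =>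
        γ (x 2) * Q (Function.update x 0 u) / (1 + b * x 2 * Q (Function.update x 0 u) * x 1) := by
      funext u; rw [hG0, hE]; simp only [Function.update_of_ne h10, Function.update_of_ne h20]
    have hDx : D0 x = γ (x 2) * R x / (1 + b * x 2 * Q (Function.update x 0 (x 0)) * x 1) ^ 2 := by
      rw [Function.update_eq_self, hD0, hE]
    have hEx : 1 + b * x 2 * Q (Function.update x 0 (x 0)) * x 1 ≠ 0 := by
      rw [Function.update_eq_self]; simpa only [hE] using hEne x hx
    rw [hfun, hDx]
    exact hillB_hasDerivAt_dir0 hQfib hEx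
  have hder1 : ∀ x ∈ C, x 1 ∈ Set.Ioo (0:ℝ) 1 →
      HasDerivAt (fun s : ℝ => G1 (Function.update x 1 s)) (D1 x) (x 1) := by
    intro x hx _
    have hQ1 : ∀ u, Q (Function.update x 1 u) = Q x := fun u => by
      rw [hQ]; simp only [Function.update_of_ne h01, Function.update_of_ne h21]
    have hR1 : ∀ u, R (Function.update x 1 u) = R x := fun u => by
      rw [hR]; simp only [Function.update_of_ne h01, Function.update_of_ne h21]
    have hP1 : ∀ u, P (Function.update x 1 u) = P x := fun u => by
      rw [hP]; simp only [hQ1, Function.update_of_ne h21]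
    have hfun : (fun u : ℝ => G1 (Function.update x 1 u)) = fun u =>
        γ (x 2) * u * R x * (1 / P x - 1 / (1 + b * x 2 * Q x * u)) := by
      funext u
      rw [hG1, hE]
      simp only [Function.update_self, Function.update_of_ne h21, hQ1, hR1, hP1]
    have hDx : D1 x = γ (x 2) * R x * (1 / P x - 1 / (1 + b * x 2 * Q x * x 1) ^ 2) := by
      rw [hD1, hE]
    have hEx : 1 + b * x 2 * Q x * x 1 ≠ 0 := by simpa only [hE] using hEne x hx
    rw [hfun, hDx]
    exact hillB_hasDerivAt_dir1 hEx
  -- the two cube representations of the integrands `Dⱼ` (all faces vanish)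
  obtain ⟨q0, hq0d, hq0i⟩ := exists_cubeRep 3 D0 hD0sa hD0c
  obtain ⟨q1, hq1d, hq1i⟩ := exists_cubeRep 3 D1 hD1sa hD1c
  -- assemble the two elements
  have hdec : FibStokesDecomposable 3 (fun x => ∑ j, ((![q0, q1] : Fin 2 → IntegralRep 3) j).integrand x) := by
    refine fibStokesDecomposable_of_elements (M := 3) (J := 2) (![0, 1] : Fin 2 → Fin 3)
      (![G0, G1] : Fin 2 → (Fin 3 → ℝ) → ℝ) (![D0, D1] : Fin 2 → (Fin 3 → ℝ) → ℝ)
      (![q0, q1] : Fin 2 → IntegralRep 3) ?_ ?_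
    · refine Fin.forall_fin_two.mpr ⟨?_, ?_⟩
      · simp only [Matrix.cons_val_zero]
        refine ⟨hG0sa, hD0sa, hbound hG0c, fun x hx => ?_, hder0⟩
        exact hG0c.comp (hcu x 0).continuousOn fun s hs => hupd x hx 0 s hs
      · simp only [Matrix.cons_val_one, Matrix.cons_val_zero]
        refine ⟨hG1sa, hD1sa, hbound hG1c, fun x hx => ?_, hder1⟩
        exact hG1c.comp (hcu x 1).continuousOn fun s hs => hupd x hx 1 s hs
    · refine Fin.forall_fin_two.mpr ⟨?_, ?_⟩
      · simp only [Matrix.cons_val_zero]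
        refine ⟨hq0d, fun x _ => ?_⟩
        rw [hq0i, hG0face x 1 (Or.inr rfl), hG0face x 0 (Or.inl rfl), sub_zero, sub_zero]
      · simp only [Matrix.cons_val_one, Matrix.cons_val_zero]
        refine ⟨hq1d, fun x _ => ?_⟩
        rw [hq1i, hG1one, hG1zero, sub_zero, sub_zero]
  -- the pointwise identity `D₀ + D₁ = γ R/P = γ · [bracket]` on the cube
  refine fibStokesDecomposable_congr_off_null 3 _ _ ∅
    Literature.ModelTheory.ExponentialFields.isSemialgebraic_empty measure_empty (fun x hx _ => ?_) hdec
  have hsum : D0 x + D1 x = γ (x 2) * (R x / P x) := by simp only [hD0, hD1]; ring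
  have hkey : R x / P x = (1 - a) / (1 - b * x 2 + b * x 2 * (1 - a) * x 0) - 1 / (1 - b * x 2 * x 0) +
      a / (1 - a * b * x 2 * x 0) := by
    have h1 := (hden1 x hx).ne'
    have h2 := (hden2 x hx).ne'
    have h3 := (hden3 x hx).ne'
    have h4 := (hden4 x hx).ne'
    have h3' : 1 - b * x 2 * a * x 0 ≠ 0 := by convert h3 using 2; ring
    rw [hPalt x hx, hR]
    beta_reduce
    field_simp
    ring
  simp only [Fin.sum_univ_two, Matrix.cons_val_zero, Matrix.cons_val_one, hq0i, hq1i]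
  rw [hsum, hkey]

end Summit.KontsevichZagierPeriods.KontsevichZagierPeriods.Cruxes.StokesGeneration.FibrewiseStokes

end
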